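import Literature.NumberTheory.Rogawski1990.LocalDeltaTransferLeviStratum            -- ★ engines `finsum_delta_mul_classOrbitalIntegral_eq_of_unique`, `stableOrbitalIntegralRel_eq_classOrbitalIntegral_of_unique`; brings ★ `UnitFundamentalLemmaInertLevi` (template + `isUnit_vecCons_sub_of_levi`, `isConj_of_isLocalStablyConjH_of_levi`)
import Summits.HodgeConjecture.HodgeConjecture.Theorems.R90S6TransferFactorDiag      -- ★ W7-d `transferFactor_diag_value` (`Δ‴_v = (−q)^{log v_w χ_g(u)}` on the regular diagonal torus, no integrality)
import Summits.HodgeConjecture.HodgeConjecture.Theorems.R90S6HyperbolicJacobians     -- ★ F5 (B2c) `satakeWeight_lineTwo`, `satakeWeight_lineThree_residueCardSqrt`; brings `satakeWeight`, `residueCardSqrt`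
import Literature.NumberTheory.Automorphic.UnitaryGroupRegularTwistModulus            -- ★ `unitModulusChar_localRing_eq_prod` lineage (`‖·‖ = ∏_w |·|_w`)
import Literature.NumberTheory.Automorphic.AdicCompletionUniformizerResidueCardGlue    -- ★ `residueFieldCard_adicCompletion_eq_absNorm`
import Literature.NumberTheory.Automorphic.ValuedFieldValuativeRelBridge               -- ★ `natCard_residueField_eq_of_compatible`
import HarnessLib

/-!
# R90 · S6 «Ch. 14.1–14.5 stable TF» — card F5 (B2d): THE HYPERBOLIC (LEVI-STRATUM) CLAUSE OF THE HECKE-ALGEBRA FUNDAMENTAL LEMMA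
# at Rogawski's `Δ‴_v`, from Cartier-shaped orbital-integral values (`Theorems/R90S6HyperbolicHeckeFL.lean`)

Cell `hodgecm-mathlib`, crux H413 (`stmt-HodgeConjecture-24833`), route of record `HCCMUnconditional`; programme R90-TF (brief `director/R90-BRIEF.v2.md`
1f40d54518340a35), section S6 (base `R90-C14`, dealer R90-C14-plan (g2)), seat R90-C14-p09 (g2); CARD F5 (B2d) dealt BY NAME 2026-09-05T01:26:01Z (R90 bus),
cut R1 «frame-free, Hecke-free HEAD with value binders» ruled «=» 01:34:52Z, currency R2 ruled 01:35:34Z; DAG row E1.3.6.2 «constant-term identity on the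
diagonal tori = hyperbolic half of Prop. 4.9.1 (b)».  Lane `--kind proof --supports stmt-HodgeConjecture-24833 --as helper`; THEOREMS ONLY (no definition,
no instance, no notation, no named fact, no kit, no `sorry`); imports = ★ `LocalDeltaTransferLeviStratum` + ★ `Theorems/R90S6TransferFactorDiag` (W7-d) +
★ `Theorems/R90S6HyperbolicJacobians` (B2c) + ★ `UnitaryGroupRegularTwistModulus` + ★ `AdicCompletionUniformizerResidueCardGlue` + ★ `ValuedFieldValuativeRelBridge`
+ HarnessLib (Theorems → Theorems ∕ Literature; never `Lines/`).

## THE PRINT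
[Rogawski1990, §4.9 pp. 54–56]: Prop. 4.9.1 (b) «if `f ∈ ℋ_G` then `ξ̂_H(f)` is a transfer of `f`», proved through (4.9.2) «`Φ(γ, f) = |D(γ)|⁻¹ f^{(B)}(γ)`»
and Lemma 4.9.2 (characters of the unramified principal series against orbital integrals on the Levi `M`): on the diagonal torus both sides of the transfer
identity (4.3.1) «`Φ^{st}(γ_H, f^H) = Σ Δ(γ_H, γ) Φ(γ, f)`» (§4.3 p. 43) have ONE term («`{γ}_{st} ∩ M` is a single conjugacy class», §3.5), the orbital integrals are
constant terms `f^{(B)}` weighted by `|D|⁻¹`, the constant terms are Satake coefficients ([CartierCorvallis1979, §IV (4.2) p. 146] «`(Sf)(m) = δ(m)^{1∕2} ∫_N f(mn) dn`»),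
and `ξ̂_H(f)^∧(z) = f^∧(−z)` turns the `H`-coefficient on the line `ℓ²_m` into `(−1)^m` times the `G`-coefficient on `ℓ³_m`; the transfer factor
`Δ_{G∕H} = τ D_{G∕H}` (p. 55) supplies exactly the compensating `(−q)`-power.

## WHAT IS PROVED (namespace `Summit.HodgeConjecture.HodgeConjecture.R90.S6`; `H_v = U(Φ₂)(L⁺_v) × U(Φ₁)(L⁺_v)`, `G′_v = U(H′)(L⁺_v)`, `L` CM, `v` finite)
* §1 **`stableOrbitalIntegralRel_eq_finsum_delta_of_levi_of_one_term`** — for ANY local transfer factor `T`, ANY families `mH`, `mG`, ANY test functions `f^H`, `f`,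
  `γ_H = (diag(d′₀, d′₁), u)` on the LEVI STRATUM (`d′₀⁻¹u − 1`, `d′₀⁻¹d′₁ − 1`, `u − d′₁` units) and a norm pair `γ₀`: the ONE-TERM identity
  `Φ(⟦γ_H⟧, f^H) = T.Δ γ_H γ₀ · Φ(⟦γ₀⟧, f)` implies the clause `Φ^st(γ_H, f^H) = ∑ᶠ c, T.Δ γ_H (out c) · Φ(c, f)` of ★ `isLocalDeltaTransfer_iff` (the two ★ engines
  of `LocalDeltaTransferLeviStratum` with the ★ Levi uniqueness binders; no canonicity, no integrality, no regularity beyond the three units).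
* §2 **`hyperbolic_scalar_identity`** — the cancellation `B⁻¹ · (q^{−m})⁻¹ · (−1)^m S = (−q)^{2n+m} · (Q^{m+n} B)⁻¹ · ((Q^m)⁻¹)⁻¹ · S` in `ℂ` (`Q = q²`), uniform in
  `m, n ∈ ℤ` (it specialises to ★ (B2c) `hyperbolicJacobian_identity_of_pos ∕ _of_neg` at `n = 0` resp. `n = −m`, and covers the residual strata `m = 0`, `n ≥ 0`).
* §3 **`stableOrbitalIntegralRel_eq_finsum_finExplicitDelta_of_levi_of_values`** (THE HEAD) — at a non-split (`c • w = w`) unramified place, `H′` of good reduction at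
  `w`, `μ` unramified at `w` under the μ-guard `μ|_{𝕀_{L⁺}} = ω_{L∕L⁺}`, Rogawski's EXPLICIT factor `Δ‴_v` (★ `finExplicitCollection`), ANY `mH`, `mG`, `f^H`, `f`,
  `γ_H` on the Levi stratum with `ord_w d′₀ = m` (binder `hm : v_w(d′₀,w) = exp(−m)`, ANY `m ∈ ℤ`), a norm pair `γ₀`, numbers `S₂ = (−1)^m S₃`, and the two
  CARTIER-SHAPED VALUE BINDERS `hΦH : Φ(⟦γ_H⟧, f^H) = (√‖b−1‖)⁻¹ · w₂(ℓ²_m)⁻¹ · S₂`, `hΦG : Φ(⟦γ₀⟧, f) = (‖a−1‖·√‖b−1‖)⁻¹ · w₃(ℓ³_m)⁻¹ · S₃` (`a = d′₀⁻¹u`,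
  `b = d′₀⁻¹d′₁`, modules ★ `unitModulusChar (LocalRing L v)`, weights ★ `satakeWeight (residueCardSqrt L_w)` on B3's line letters): the clause
  `Φ^st(γ_H, f^H) = ∑ᶠ c, Δ‴_v(γ_H, out c) · Φ(c, f)`.  PROOF: §1, with the one-term identity reduced to §2 by ★ W7-d `transferFactor_diag_value`
  (`Δ‴_v = (−#k_v)^{log v_w((u − d′₀)(u − d′₁))}` on the whole regular diagonal torus) and the UNIFORM exponent bookkeeping at the `c`-fixed place `w`
  (★ `HeisRing.torus_relations`, ★ `conjLocal_apply_eq_galAdicCompletionMap`, ★ `valued_galAdicCompletionMap`, ★ `valued_finGammaTwo_apply_eq_one`):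
  `v_w(u) = 1`, `u − d′₁ = (σu · σd′₀)⁻¹ σ(d′₀ − u)` ⇒ `log v_w((u−d′₀)(u−d′₁)) = 2n₁ + m`, `v_w(a − 1) = exp(m + n₁)` (`n₁ = log v_w(u − d′₀)`), hence
  `‖a − 1‖ = Q^{m+n₁}` (★ `unitModulusChar_localRing_eq_prod`, ★ `normAbs_eq_inv_zpow_of_valued_eq`), in the single currency `q = #k_v`: `#k_w = Q = q²`
  (★ `residueFieldCard_adicCompletion_eq_absNorm`, ★ `absNorm_placesOver_eq_sq_of_nonsplit_of_isUnramifiedIn`, ★ `natCard_residueField_eq_of_compatible`),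
  `residueCardSqrt L_w = q`, `w₂(ℓ²_m) = q^{−m}` (★ `satakeWeight_lineTwo`), `w₃(ℓ³_m) = (Q^m)⁻¹` (★ `satakeWeight_lineThree_residueCardSqrt`); `√‖b − 1‖` cancels.
CONSUMERS (card F5 ∕ row E1.3.6.2): the sequel `Theorems/R90S6HyperbolicHeckeFLClosed.lean` instantiates `hΦG` by R90-C14-p01's (B2a) `classOrbitalIntegral_coeff_toVector_frame_eq`
(★-to-be `R90S6ConstantTermTransportValue`, bridged through ★ `twistModule_cmLocal_eq`), `hΦH` by its `H`-twin, and `hS` by ★ B3 `coeff_satakeTransform_satakeGraphPartner`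
(p864105) for a Satake-graph pair `(φ, φ^H)`; the frames `eG`, `eH` and `heckeToFun` of the S6 floor socket `StubR90ExtE1HeckeFL` enter only there (Theorems ↛ Lines).
HONEST LABEL: helper theorem, count-neutral until E1.3.6.2 closes; proves no printed global statement by itself, discharges no citation.  HC_CM is proved only
modulo the 7 printed citations (2 remaining named inputs: hLiu418 = stmt-HodgeConjecture-24832, h413 = stmt-HodgeConjecture-24833) until rung 0 closes; REL ≠ ★ ≠ BUILT.

## Tree search (dedup)
`rg "of_levi_of_one_term|of_levi_of_values|hyperbolic_scalar_identity|HyperbolicHeckeFL"` over `lean/` — no hit (2026-09-05T01:40Z); REUSED ★ (by name, not restated):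
`finsum_delta_mul_classOrbitalIntegral_eq_of_unique`, `stableOrbitalIntegralRel_eq_classOrbitalIntegral_of_unique`, `isConj_of_isLocalStablyConjH_of_levi`,
`isConj_of_isLocalNormPair_of_isLocalNormPair_of_levi`, `isUnit_vecCons_sub_of_levi`, `endoEmbLocal_eq_glDiagonal_of_fst_eq`, `transferFactor_diag_value`,
`satakeWeight_lineTwo`, `satakeWeight_lineThree_residueCardSqrt`, `unitModulusChar_localRing_eq_prod`, `normAbs_eq_inv_zpow_of_valued_eq`; Mathlib `inv_sub_inv'`,
`Valuation.map_sub_swap`, `WithZero.exp_log ∕ log_exp ∕ exp_add ∕ exp_neg`, `Fintype.prod_subsingleton`, `Real.sqrt_sq`.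

## References
* [Rogawski1990] J. D. Rogawski, *Automorphic Representations of Unitary Groups in Three Variables*, Ann. of Math. Stud. 123 (1990): §4.9 Prop. 4.9.1 (b), (4.9.2),
  Lemma 4.9.2 pp. 54–56; §4.3 (4.3.1) p. 43; §3.5 Prop. 3.5.2 pp. 25–26.
* [CartierCorvallis1979] P. Cartier, *Representations of 𝔭-adic groups: a survey*, PSPM 33.1 (1979): §IV (4.2) p. 146, Thm. 4.1.
-/

set_option autoImplicit false
-- the mandated namespace repeats the single-problem summit's segment (`HodgeConjecture.HodgeConjecture`)
set_option linter.dupNamespace false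

noncomputable section

open MeasureTheory Measure Set NumberField IsDedekindDomain Matrix
open Literature.NumberTheory.Automorphic Literature.NumberTheory.Automorphic.UnitaryGroup
open Literature.NumberTheory.Automorphic.HermitianLattice
open Literature.NumberTheory.GaloisRepresentations
open Literature.NumberTheory.Rogawski1990
open Literature.NumberTheory.GaloisRepresentations.IsNonarchimedeanLocalField (residueFieldCard)
open scoped NNReal Matrix MatrixGroups Valued

namespace Summit.HodgeConjecture.HodgeConjecture.R90.S6

/-! ## §1 The clause of (4.3.1) at a Levi-stratum `γ_H` from the ONE-TERM identity, arbitrary test functions -/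

/-- **(4.3.1) at a Levi-stratum `γ_H` ⟸ the one-term identity.**  For `H′` hermitian with invertible determinant, a finite place `v` of `L⁺`,
ANY local transfer factor `T`, ANY families `mH`, `mG`, ANY test functions `f^H`, `f`, and `γ_H = (diag(d′₀, d′₁), u) ∈ H_v` on the LEVI STRATUM
(`d′₀⁻¹u − 1`, `d′₀⁻¹d′₁ − 1`, `u − d′₁` units) with a norm pair `γ₀`: if `Φ(⟦γ_H⟧, f^H) = T.Δ γ_H γ₀ · Φ(⟦γ₀⟧, f)` then
`Φ^st(γ_H, f^H) = ∑ᶠ c, T.Δ γ_H (out c) · Φ(c, f)` — both sides have one term (★ `stableOrbitalIntegralRel_eq_classOrbitalIntegral_of_unique` with ★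
`isConj_of_isLocalStablyConjH_of_levi`; ★ `finsum_delta_mul_classOrbitalIntegral_eq_of_unique` with ★ `isConj_of_isLocalNormPair_of_isLocalNormPair_of_levi`).
The converse reading of ★ `classOrbitalIntegral_eq_delta_mul_classOrbitalIntegral_of_levi`. [cite: Rogawski1990, §4.3 (4.3.1) p. 43; §4.9 Lemma 4.9.2 p. 56; §3.5 Prop. 3.5.2 pp. 25–26] -/
theorem stableOrbitalIntegralRel_eq_finsum_delta_of_levi_of_one_term (L : Type) [Field L] [NumberField L] [IsCMField L]
    (H' : Matrix (Fin 3) (Fin 3) L) (hH' : (H'.map (IsCMField.complexConj L))ᵀ = H') (hH'd : IsUnit H'.det)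
    {v : HeightOneSpectrum (𝓞 ↥(maximalRealSubfield L))}
    [∀ γ : ((cmDatum L 3 H').Local v), MeasurableSpace (((cmDatum L 3 H').Local v) ⧸ Subgroup.centralizer ({γ} : Set ((cmDatum L 3 H').Local v)))]
    [∀ a : ((cmDatum L 2 (Matrix.of fun i j : Fin 2 => if i.val + j.val + 1 = 2 then (1 : L) else 0)).Local v ×
      (cmDatum L 1 (Matrix.of fun i j : Fin 1 => if i.val + j.val + 1 = 1 then (1 : L) else 0)).Local v),
      MeasurableSpace (((cmDatum L 2 (Matrix.of fun i j : Fin 2 => if i.val + j.val + 1 = 2 then (1 : L) else 0)).Local v ×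
      (cmDatum L 1 (Matrix.of fun i j : Fin 1 => if i.val + j.val + 1 = 1 then (1 : L) else 0)).Local v) ⧸ Subgroup.centralizer ({a} : Set ((cmDatum L 2 (Matrix.of fun i j : Fin 2 => if i.val + j.val + 1 = 2 then (1 : L) else 0)).Local v ×
      (cmDatum L 1 (Matrix.of fun i j : Fin 1 => if i.val + j.val + 1 = 1 then (1 : L) else 0)).Local v)))]
    (T : LocalTransferFactor L H' v)
    (mH : OrbitalMeasureFamily ((cmDatum L 2 (Matrix.of fun i j : Fin 2 => if i.val + j.val + 1 = 2 then (1 : L) else 0)).Local v ×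
      (cmDatum L 1 (Matrix.of fun i j : Fin 1 => if i.val + j.val + 1 = 1 then (1 : L) else 0)).Local v)) (mG : OrbitalMeasureFamily ((cmDatum L 3 H').Local v))
    (fH : ((cmDatum L 2 (Matrix.of fun i j : Fin 2 => if i.val + j.val + 1 = 2 then (1 : L) else 0)).Local v ×
      (cmDatum L 1 (Matrix.of fun i j : Fin 1 => if i.val + j.val + 1 = 1 then (1 : L) else 0)).Local v) → ℂ)
    (f : (cmDatum L 3 H').Local v → ℂ)
    {γH : ((cmDatum L 2 (Matrix.of fun i j : Fin 2 => if i.val + j.val + 1 = 2 then (1 : L) else 0)).Local v ×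
      (cmDatum L 1 (Matrix.of fun i j : Fin 1 => if i.val + j.val + 1 = 1 then (1 : L) else 0)).Local v)}
    {d' : Fin 2 → (UnitaryGroup.LocalRing L v)ˣ} (hd' : glDiagonal 2 (UnitaryGroup.LocalRing L v) d' = (γH.1.val : GL (Fin 2) (UnitaryGroup.LocalRing L v)))
    (ha : IsUnit ((((d' 0)⁻¹ * (isUnit_finGammaTwo L v γH).unit : (UnitaryGroup.LocalRing L v)ˣ) : UnitaryGroup.LocalRing L v) - 1))
    (hb : IsUnit ((((d' 0)⁻¹ * d' 1 : (UnitaryGroup.LocalRing L v)ˣ) : UnitaryGroup.LocalRing L v) - 1))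
    (h12 : IsUnit (finGammaTwo L v γH - (d' 1 : UnitaryGroup.LocalRing L v)))
    {γ₀ : (cmDatum L 3 H').Local v} (h₀ : IsLocalNormPair L H' v γH γ₀)
    (hone : classOrbitalIntegral mH fH (ConjClasses.mk γH) = T.Δ γH γ₀ * classOrbitalIntegral mG f (ConjClasses.mk γ₀)) :
    stableOrbitalIntegralRel (IsLocalStablyConjH L v) mH fH γH =
      ∑ᶠ c : ConjClasses ((cmDatum L 3 H').Local v), T.Δ γH (Quotient.out c) * classOrbitalIntegral mG f c := by
  have hι := endoEmbLocal_eq_glDiagonal_of_fst_eq L v γH hd'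
  have hu : (((isUnit_finGammaTwo L v γH).unit : (UnitaryGroup.LocalRing L v)ˣ) : UnitaryGroup.LocalRing L v) = finGammaTwo L v γH :=
    (isUnit_finGammaTwo L v γH).unit_spec
  have hreg3 := isUnit_vecCons_sub_of_levi ha hb (by rw [hu]; exact h12)
  have hHC := isLocalStablyConjH_of_isConj_and_conj L γH
  have h01 : IsUnit ((d' 0 : UnitaryGroup.LocalRing L v) - d' 1) := by simpa using hreg3 0 2 (by decide)
  rw [stableOrbitalIntegralRel_eq_classOrbitalIntegral_of_unique (IsLocalStablyConjH L v) mH fH γH hHC.1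
      (fun k hst => isConj_of_isLocalStablyConjH_of_levi L hd' h01 hst),
    finsum_delta_mul_classOrbitalIntegral_eq_of_unique T mG f γH γ₀
      (fun k hk => isConj_of_isLocalNormPair_of_isLocalNormPair_of_levi L H' hH' hH'd γH hι hreg3 h₀ hk)]
  exact hone

/-! ## §2 The scalar identity `J_H · w₂⁻¹ · (−1)^m = Δ‴ · J_G · w₃⁻¹` in one currency `q = #k_v` -/

/-- **The hyperbolic cancellation, uniform in `m ∈ ℤ`**: with `q ≠ 0`, `B ≠ 0` (`B = √‖b − 1‖`), `n = log_Q ‖a − 1‖` (`Q = q²`) and the transfer-factor exponent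
`2n + m`: `B⁻¹ · (q^{−m})⁻¹ · ((−1)^m S) = (−q)^{2n+m} · ((Q^{m+n} · B)⁻¹ · ((Q^{m})⁻¹)⁻¹ · S)`. [cite: Rogawski1990, §4.9 Prop. 4.9.1 (b), (4.9.2) p. 55] -/
theorem hyperbolic_scalar_identity (q B S : ℂ) (hq : q ≠ 0) (m n : ℤ) :
    B⁻¹ * ((q ^ (-m))⁻¹ * ((-1) ^ m * S)) = (-q) ^ (2 * n + m) * (((q ^ 2) ^ (m + n) * B)⁻¹ * ((((q ^ 2) ^ m)⁻¹)⁻¹ * S)) := by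
  have h1 : (-q) ^ (2 * n + m) = (-1) ^ m * q ^ (2 * n + m) := by
    rw [neg_eq_neg_one_mul, mul_zpow, zpow_add₀ (by norm_num : (-1 : ℂ) ≠ 0), _root_.zpow_mul, zpow_two, neg_one_mul, neg_neg, _root_.one_zpow,
      one_mul]
  have h2 : ((q ^ 2) ^ (m + n) : ℂ) = q ^ (2 * (m + n)) := by rw [_root_.zpow_mul, zpow_two, sq]
  have h3 : ((q ^ 2) ^ m : ℂ) = q ^ (2 * m) := by rw [_root_.zpow_mul, zpow_two, sq]
  have h4 : q ^ (2 * n + m) * (q ^ (2 * (m + n)))⁻¹ * q ^ (2 * m) = q ^ m := by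
    rw [← _root_.zpow_neg, ← zpow_add₀ hq, ← zpow_add₀ hq]; congr 1; ring
  rw [h1, h2, h3, inv_inv, _root_.zpow_neg, inv_inv, mul_inv]
  calc B⁻¹ * (q ^ m * ((-1) ^ m * S)) = (-1) ^ m * (q ^ (2 * n + m) * (q ^ (2 * (m + n)))⁻¹ * q ^ (2 * m)) * B⁻¹ * S := by rw [h4]; ring
    _ = _ := by ring

/-! ## §3 The hyperbolic clause at `Δ‴_v` from the two Cartier-shaped values -/

/-- **THE HYPERBOLIC (LEVI-STRATUM) CLAUSE OF (4.3.1) AT ROGAWSKI'S `Δ‴_v`, FROM CARTIER-SHAPED VALUES.**  At a finite place `v` of `L⁺` non-split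
(`c • w = w`) and unramified in the CM field `L`, for `H′` hermitian with invertible determinant of good reduction at `w`, `μ` unramified at `w` under the
μ-guard, ANY families `mH`, `mG` and ANY test functions `f^H`, `f`: let `γ_H = (diag(d′₀, d′₁), u) ∈ H_v` lie on the Levi stratum (`d′₀⁻¹u − 1`,
`d′₀⁻¹d′₁ − 1`, `u − d′₁` units — free on `G`-regular data, ★ `isUnit_levi_of_isLocalGRegular_of_nonsplit`), `ord_w d′₀ = m` (`v_w(d′₀,w) = exp(−m)`, ANY
`m ∈ ℤ`: the Hecke stratum `m ≠ 0` and the residual strata `m = 0` alike), `γ₀` a norm pair.  IF the two orbital integrals have the CARTIER SHAPE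
`Φ(⟦γ_H⟧, f^H) = (√‖b − 1‖)⁻¹ · w₂(ℓ²_m)⁻¹ · S₂` and `Φ(⟦γ₀⟧, f) = (‖a − 1‖ · √‖b − 1‖)⁻¹ · w₃(ℓ³_m)⁻¹ · S₃` (`a = d′₀⁻¹u`, `b = d′₀⁻¹d′₁`; `w_N` the
`δ^{1∕2}`-Satake weights ★ `satakeWeight (residueCardSqrt L_w)` on the lines `ℓ²_m = (m, −m)`, `ℓ³_m = (m, 0, −m)`; e.g. `S_N` = the Satake coefficients of
Hecke operators, by ★ (B1) `integral_coeff_toVector_mul_eq` through the ★ canonical torus descents) with `S₂ = (−1)^m S₃` (★ B3 `coeff_satakeTransform_satakeGraphPartner`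
for a Satake-graph pair), THEN the clause of ★ `isLocalDeltaTransfer_iff` holds at `γ_H`:
`Φ^st(γ_H, f^H) = ∑ᶠ c, Δ‴_v(γ_H, out c) · Φ(c, f)`.  Proof: §1 + the one-term identity, which is the scalar identity §2 after ★ `transferFactor_diag_value`
(`Δ‴_v = (−q)^{2n₁ + m}`, `n₁ = log v_w(u − d′₀)`), `‖a − 1‖ = Q^{n₁ + m}` (★ `unitModulusChar_localRing_eq_prod`, ★ `normAbs_eq_inv_zpow_of_valued_eq`), `w₂(ℓ²_m) = q^{−m}`,
`w₃(ℓ³_m) = Q^{−m}` (★ (B2c)), `Q = #𝓀_w = q²`, `q = #k_v` (★ `absNorm_placesOver_eq_sq_of_nonsplit_of_isUnramifiedIn`).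
[cite: Rogawski1990, §4.9 Prop. 4.9.1 (b), (4.9.2), Lemma 4.9.2 pp. 55–56; §4.3 (4.3.1) p. 43] [cite: CartierCorvallis1979, §IV (4.2) p. 146] -/
theorem stableOrbitalIntegralRel_eq_finsum_finExplicitDelta_of_levi_of_values
    (L : Type) [Field L] [NumberField L] [IsCMField L] (H' : Matrix (Fin 3) (Fin 3) L)
    (hH' : (H'.map (IsCMField.complexConj L))ᵀ = H') (hH'd : IsUnit H'.det)
    {v : HeightOneSpectrum (𝓞 ↥(maximalRealSubfield L))} (w : PlacesOver L v)
    (hw : IsCMField.complexConj L • w.1 = w.1) (hv : Algebra.IsUnramifiedIn (𝓞 L) v.asIdeal)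
    (hH'w : IsUnit (placeForm H' w.1)) (hH'i : hH'w.unit ∈ glInt 3 (w.1.adicCompletion L))
    (μ : HeckeCharacter L) (hμ : μ.IsUnramifiedAt w.1)
    (hμω : ∀ x : ideleGroup ↥(maximalRealSubfield L), μ (AdeleRing.ideleBaseChange ↥(maximalRealSubfield L) L x) = quadraticHeckeCharCM L x)
    [∀ γ : ((cmDatum L 3 H').Local v), MeasurableSpace (((cmDatum L 3 H').Local v) ⧸ Subgroup.centralizer ({γ} : Set ((cmDatum L 3 H').Local v)))]
    [∀ a : ((cmDatum L 2 (Matrix.of fun i j : Fin 2 => if i.val + j.val + 1 = 2 then (1 : L) else 0)).Local v ×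
      (cmDatum L 1 (Matrix.of fun i j : Fin 1 => if i.val + j.val + 1 = 1 then (1 : L) else 0)).Local v),
      MeasurableSpace (((cmDatum L 2 (Matrix.of fun i j : Fin 2 => if i.val + j.val + 1 = 2 then (1 : L) else 0)).Local v ×
      (cmDatum L 1 (Matrix.of fun i j : Fin 1 => if i.val + j.val + 1 = 1 then (1 : L) else 0)).Local v) ⧸ Subgroup.centralizer ({a} : Set ((cmDatum L 2 (Matrix.of fun i j : Fin 2 => if i.val + j.val + 1 = 2 then (1 : L) else 0)).Local v ×
      (cmDatum L 1 (Matrix.of fun i j : Fin 1 => if i.val + j.val + 1 = 1 then (1 : L) else 0)).Local v)))]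
    (hl : ∀ (v : HeightOneSpectrum (𝓞 ↥(maximalRealSubfield L))) (a : ((cmDatum L 2 (Matrix.of fun i j : Fin 2 => if i.val + j.val + 1 = 2 then (1 : L) else 0)).Local v ×
      (cmDatum L 1 (Matrix.of fun i j : Fin 1 => if i.val + j.val + 1 = 1 then (1 : L) else 0)).Local v)) (b : (cmDatum L 3 H').Local v) (x : ((cmDatum L 2 (Matrix.of fun i j : Fin 2 => if i.val + j.val + 1 = 2 then (1 : L) else 0)).Local v ×
      (cmDatum L 1 (Matrix.of fun i j : Fin 1 => if i.val + j.val + 1 = 1 then (1 : L) else 0)).Local v)),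
      finExplicitDelta L v H' (x * a * x⁻¹) μ b = finExplicitDelta L v H' a μ b)
    (hr : ∀ (v : HeightOneSpectrum (𝓞 ↥(maximalRealSubfield L))) (a : ((cmDatum L 2 (Matrix.of fun i j : Fin 2 => if i.val + j.val + 1 = 2 then (1 : L) else 0)).Local v ×
      (cmDatum L 1 (Matrix.of fun i j : Fin 1 => if i.val + j.val + 1 = 1 then (1 : L) else 0)).Local v)) (b y : (cmDatum L 3 H').Local v),
      finExplicitDelta L v H' a μ (y * b * y⁻¹) = finExplicitDelta L v H' a μ b)
    (mH : OrbitalMeasureFamily ((cmDatum L 2 (Matrix.of fun i j : Fin 2 => if i.val + j.val + 1 = 2 then (1 : L) else 0)).Local v ×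
      (cmDatum L 1 (Matrix.of fun i j : Fin 1 => if i.val + j.val + 1 = 1 then (1 : L) else 0)).Local v)) (mG : OrbitalMeasureFamily ((cmDatum L 3 H').Local v))
    (fH : ((cmDatum L 2 (Matrix.of fun i j : Fin 2 => if i.val + j.val + 1 = 2 then (1 : L) else 0)).Local v ×
      (cmDatum L 1 (Matrix.of fun i j : Fin 1 => if i.val + j.val + 1 = 1 then (1 : L) else 0)).Local v) → ℂ)
    (f : (cmDatum L 3 H').Local v → ℂ)
    {γH : ((cmDatum L 2 (Matrix.of fun i j : Fin 2 => if i.val + j.val + 1 = 2 then (1 : L) else 0)).Local v ×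
      (cmDatum L 1 (Matrix.of fun i j : Fin 1 => if i.val + j.val + 1 = 1 then (1 : L) else 0)).Local v)}
    {d' : Fin 2 → (UnitaryGroup.LocalRing L v)ˣ} (hd' : glDiagonal 2 (UnitaryGroup.LocalRing L v) d' = (γH.1.val : GL (Fin 2) (UnitaryGroup.LocalRing L v)))
    (ha : IsUnit ((((d' 0)⁻¹ * (isUnit_finGammaTwo L v γH).unit : (UnitaryGroup.LocalRing L v)ˣ) : UnitaryGroup.LocalRing L v) - 1))
    (hb : IsUnit ((((d' 0)⁻¹ * d' 1 : (UnitaryGroup.LocalRing L v)ˣ) : UnitaryGroup.LocalRing L v) - 1))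
    (h12 : IsUnit (finGammaTwo L v γH - (d' 1 : UnitaryGroup.LocalRing L v)))
    {m : ℤ} (hm : Valued.v ((d' 0 : UnitaryGroup.LocalRing L v) w) = WithZero.exp (-m))
    {γ₀ : (cmDatum L 3 H').Local v} (h₀ : IsLocalNormPair L H' v γH γ₀)
    {S₂ S₃ : ℂ} (hS : S₂ = (-1 : ℂ) ^ m * S₃)
    (hΦH : classOrbitalIntegral mH fH (ConjClasses.mk γH) =
      ((((NNReal.sqrt (unitModulusChar (UnitaryGroup.LocalRing L v) hb.unit))⁻¹ : ℝ≥0) : ℝ) : ℂ) *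
        ((satakeWeight (residueCardSqrt (w.1.adicCompletion L)) (fun i : Fin 2 => m * (1 - 2 * ((i : ℕ) : ℤ))))⁻¹ * S₂))
    (hΦG : classOrbitalIntegral mG f (ConjClasses.mk γ₀) =
      ((((unitModulusChar (UnitaryGroup.LocalRing L v) ha.unit * NNReal.sqrt (unitModulusChar (UnitaryGroup.LocalRing L v) hb.unit))⁻¹ : ℝ≥0) : ℝ) : ℂ) *
        ((satakeWeight (residueCardSqrt (w.1.adicCompletion L)) (fun i : Fin 3 => m * (1 - ((i : ℕ) : ℤ))))⁻¹ * S₃)) :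
    stableOrbitalIntegralRel (IsLocalStablyConjH L v) mH fH γH =
      ∑ᶠ c : ConjClasses ((cmDatum L 3 H').Local v), (finExplicitCollection L H' μ hl hr v).Δ γH (Quotient.out c) * classOrbitalIntegral mG f c := by
  haveI hsub : Subsingleton (PlacesOver L v) :=
    PlacesOver.subsingleton_of_smul_eq (IsCMField.complexConj L) (IsCMField.complexConj_ne_one L) w hw
  have hι := endoEmbLocal_eq_glDiagonal_of_fst_eq L v γH hd'
  have hu : (((isUnit_finGammaTwo L v γH).unit : (UnitaryGroup.LocalRing L v)ˣ) : UnitaryGroup.LocalRing L v) = finGammaTwo L v γH :=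
    (isUnit_finGammaTwo L v γH).unit_spec
  have hreg3 := isUnit_vecCons_sub_of_levi ha hb (by rw [hu]; exact h12)
  -- STEP 1: `Δ‴_v(γ_H, γ₀) = (−q)^{log v_w((u − d′₀)(u − d′₁))}` (★ W7-d)
  have hΔ : (finExplicitCollection L H' μ hl hr v).Δ γH γ₀ =
      (-(Ideal.absNorm v.asIdeal : ℂ)) ^ WithZero.log (Valued.v
        (((finGammaTwo L v γH - (d' 0 : UnitaryGroup.LocalRing L v)) * (finGammaTwo L v γH - (d' 1 : UnitaryGroup.LocalRing L v))) w)) := by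
    have h := transferFactor_diag_value L H' hH' hH'd w hw hv hH'w hH'i μ hμ hμω γH hι hreg3 h₀
    simp only [Matrix.cons_val_zero, Matrix.cons_val_one, Matrix.cons_val_two, Matrix.tail_cons, Matrix.head_cons, hu] at h
    exact h
  -- STEP 2: the three coordinates at the place `w` and the torus relations there
  set σw := galAdicCompletionMap (L := L) (IsCMField.complexConj L) hw with hσw
  set x₀ : w.1.adicCompletion L := (d' 0 : UnitaryGroup.LocalRing L v) w with hx₀
  set xu : w.1.adicCompletion L := finGammaTwo L v γH w with hxu
  set x₁ : w.1.adicCompletion L := (d' 1 : UnitaryGroup.LocalRing L v) w with hx₁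
  have hvu : Valued.v xu = 1 := valued_finGammaTwo_apply_eq_one L v γH w hw
  have ht := endoEmbLocal_mem_torusU_of_endoEmbLocal_eq L v γH hι
  obtain ⟨-, h11, h02⟩ := HeisRing.torus_relations (conjLocal L (IsCMField.complexConj L) v) (cmLocalForm_eq_over L 3 v) ⟨_, ht⟩ hι.symm
  simp only [Matrix.cons_val_zero, Matrix.cons_val_one, Matrix.cons_val_two, Matrix.tail_cons, Matrix.head_cons, hu] at h11 h02
  have h11w : σw xu * xu = 1 := by
    have h := congrFun h11 w
    rwa [Pi.mul_apply, Pi.one_apply, conjLocal_apply_eq_galAdicCompletionMap L v w hw] at h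
  have h02w : σw x₀ * x₁ = 1 := by
    have h := congrFun h02 w
    rwa [Pi.mul_apply, Pi.one_apply, conjLocal_apply_eq_galAdicCompletionMap L v w hw] at h
  have hx₀0 : x₀ ≠ 0 := by
    intro h; rw [h, map_zero] at hm; exact (WithZero.coe_ne_zero).symm hm
  have hσu0 : σw xu ≠ 0 := fun h => by rw [h, zero_mul] at h11w; exact zero_ne_one h11w
  have hσ00 : σw x₀ ≠ 0 := fun h => by rw [h, zero_mul] at h02w; exact zero_ne_one h02w
  -- `u − d′₀` is a unit (regularity), `n₁ := log v_w(u − d′₀)`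
  have hne : xu - x₀ ≠ 0 := by
    have h := (hreg3 1 0 (by decide)).map (Pi.evalRingHom (fun w' : PlacesOver L v => w'.1.adicCompletion L) w)
    simp only [Matrix.cons_val_zero, Matrix.cons_val_one, hu, map_sub, Pi.evalRingHom_apply] at h
    exact h.ne_zero
  set n₁ : ℤ := WithZero.log (Valued.v (xu - x₀)) with hn₁
  have hv10 : Valued.v (xu - x₀) = WithZero.exp n₁ := by
    rw [hn₁, WithZero.exp_log]
    exact (Valuation.ne_zero_iff _).2 hne
  -- (K1) `v(u − x₁) = exp m · v(u − x₀)`: `u − x₁ = (σu)⁻¹ − (σx₀)⁻¹ = (σu)⁻¹ (σx₀ − σu) (σx₀)⁻¹`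
  have hv11 : Valued.v (xu - x₁) = WithZero.exp (m + n₁) := by
    have e1 : xu = (σw xu)⁻¹ := eq_inv_of_mul_eq_one_right h11w
    have e2 : x₁ = (σw x₀)⁻¹ := eq_inv_of_mul_eq_one_right h02w
    have e3 : xu - x₁ = (σw xu)⁻¹ * (σw (x₀ - xu)) * (σw x₀)⁻¹ := by
      rw [map_sub, ← inv_sub_inv' hσu0 hσ00, ← e1, ← e2]
    rw [e3, map_mul, map_mul, map_inv₀, map_inv₀, hσw, valued_galAdicCompletionMap, valued_galAdicCompletionMap, valued_galAdicCompletionMap,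
      hvu, hm, inv_one, one_mul, Valuation.map_sub_swap, hv10, ← WithZero.exp_neg, neg_neg, ← WithZero.exp_add, add_comm]
  -- (K2) `v(a − 1) = v(x₀⁻¹(u − x₀)) = exp (m + n₁)`
  have hva : Valued.v (x₀⁻¹ * xu - 1) = WithZero.exp (m + n₁) := by
    rw [show x₀⁻¹ * xu - 1 = x₀⁻¹ * (xu - x₀) by rw [mul_sub, inv_mul_cancel₀ hx₀0], map_mul, map_inv₀, hm, hv10, ← WithZero.exp_neg, neg_neg,
      WithZero.exp_add]
  -- the transfer-factor exponent: `log v_w((u − d′₀)(u − d′₁)) = 2n₁ + m`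
  have hexp : WithZero.log (Valued.v (((finGammaTwo L v γH - (d' 0 : UnitaryGroup.LocalRing L v)) *
      (finGammaTwo L v γH - (d' 1 : UnitaryGroup.LocalRing L v))) w)) = 2 * n₁ + m := by
    rw [Pi.mul_apply, Pi.sub_apply, Pi.sub_apply, ← hxu, ← hx₀, ← hx₁, map_mul, hv10, hv11, ← WithZero.exp_add, WithZero.log_exp]
    ring
  -- STEP 3: `‖a − 1‖ = Q^{m + n₁}` in the currency `q = #k_v`, `Q = q²`
  have hq0 : (Ideal.absNorm v.asIdeal : ℂ) ≠ 0 := by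
    exact_mod_cast (Ideal.absNorm_eq_zero_iff.not.2 v.ne_bot)
  have hQ : residueFieldCard (w.1.adicCompletion L) = Ideal.absNorm v.asIdeal ^ 2 := by
    rw [residueFieldCard_adicCompletion_eq_absNorm, absNorm_placesOver_eq_sq_of_nonsplit_of_isUnramifiedIn L v w hw hv]
  have hA : ((unitModulusChar (UnitaryGroup.LocalRing L v) ha.unit : ℝ≥0) : ℝ) = ((Ideal.absNorm v.asIdeal : ℝ) ^ 2) ^ (m + n₁) := by
    have hinv : (((d' 0)⁻¹ : (UnitaryGroup.LocalRing L v)ˣ) : UnitaryGroup.LocalRing L v) w = x₀⁻¹ := by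
      refine eq_inv_of_mul_eq_one_left ?_
      have h := congrFun (congrArg (fun u : (UnitaryGroup.LocalRing L v)ˣ => (u : UnitaryGroup.LocalRing L v)) (inv_mul_cancel (d' 0))) w
      simpa only [Units.val_mul, Pi.mul_apply, Units.val_one, Pi.one_apply] using h
    have haw : ((ha.unit : (UnitaryGroup.LocalRing L v)ˣ) : UnitaryGroup.LocalRing L v) w = x₀⁻¹ * xu - 1 := by
      rw [ha.unit_spec, Pi.sub_apply, Pi.one_apply, Units.val_mul, Pi.mul_apply, hinv, hu]
    rw [unitModulusChar_localRing_eq_prod, Fintype.prod_subsingleton _ w, haw, normAbs_eq_inv_zpow_of_valued_eq w.1 hva, hQ]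
    push_cast
    rw [_root_.inv_zpow', neg_neg]
  -- STEP 4: the Satake weights in the same currency
  have hcardN : Nat.card 𝓀[w.1.adicCompletion L] = Ideal.absNorm v.asIdeal ^ 2 := by
    rw [← hQ]
    unfold residueFieldCard
    exact (natCard_residueField_eq_of_compatible (K := w.1.adicCompletion L)).symm
  have hcard : (Nat.card 𝓀[w.1.adicCompletion L] : ℂ) = (Ideal.absNorm v.asIdeal : ℂ) ^ 2 := by
    rw [hcardN, Nat.cast_pow]
  have hrcs : residueCardSqrt (w.1.adicCompletion L) = (Ideal.absNorm v.asIdeal : ℂ) := by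
    rw [residueCardSqrt, hcardN, Nat.cast_pow, Real.sqrt_sq (Nat.cast_nonneg _), Complex.ofReal_natCast]
  have hW₂ : satakeWeight (residueCardSqrt (w.1.adicCompletion L)) (fun i : Fin 2 => m * (1 - 2 * ((i : ℕ) : ℤ))) =
      (Ideal.absNorm v.asIdeal : ℂ) ^ (-m) := by
    rw [← hrcs]; exact satakeWeight_lineTwo _ m
  have hW₃ : satakeWeight (residueCardSqrt (w.1.adicCompletion L)) (fun i : Fin 3 => m * (1 - ((i : ℕ) : ℤ))) =
      (((Ideal.absNorm v.asIdeal : ℂ) ^ 2) ^ m)⁻¹ := by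
    rw [← hcard]; exact satakeWeight_lineThree_residueCardSqrt _ m
  -- STEP 5: the one-term identity is the scalar identity §2
  refine stableOrbitalIntegralRel_eq_finsum_delta_of_levi_of_one_term L H' hH' hH'd (finExplicitCollection L H' μ hl hr v) mH mG fH f hd' ha hb h12 h₀ ?_
  have hA' : (((unitModulusChar (UnitaryGroup.LocalRing L v) ha.unit : ℝ≥0) : ℝ) : ℂ) = ((Ideal.absNorm v.asIdeal : ℂ) ^ 2) ^ (m + n₁) := by
    rw [hA]; push_cast; rfl
  rw [hΦH, hΦG, hΔ, hexp, hS, hW₂, hW₃]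
  simp only [NNReal.coe_inv, NNReal.coe_mul, Complex.ofReal_inv, Complex.ofReal_mul]
  rw [hA']
  exact hyperbolic_scalar_identity _ _ S₃ hq0 m n₁

end Summit.HodgeConjecture.HodgeConjecture.R90.S6

end
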